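import Literature.NumberTheory.NumberFields.RingClassFieldAbelian
import Literature.NumberTheory.NumberFields.RingClassFieldOfConductor
import Mathlib.NumberTheory.LegendreSymbol.JacobiSymbol
import Mathlib.FieldTheory.Finite.Basic
import HarnessLib

/-!
# A square root in the ring class field makes the quadratic symbol `(m / N(α))` trivial on
# `P_{K,ℤ}(f)` (Artin reciprocity for `K(√m) ⊆ R_f`; Cox, *Primes of the form x² + ny²*, §9.A)

Topic `NumberTheory/NumberFields` (sequel of `RingClassFieldAbelian.lean`). THEOREMS only — no definition,
no named fact (D-0026); everything is proved from the tree's (proved) class field theory of the ring class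
field (`RingClassField.exists_ringClassCharacter_of_character_galFrob`, the Artin isomorphism
`I_K(f)/P_{K,ℤ}(f) ≃ Gal(R_f/K)` in dual form) and Mathlib's Jacobi symbol.

Let `K` be a number field, `f ≥ 1`, and `R ⊆ K̄` the ring class field of conductor `f` in the tree's
class-field currency (finite Galois over `K`, unramified off `f`, a prime `v ∤ f` splits completely iff
`[𝔭_v] = 1` in `I_K(f)/P_{K,ℤ}(f)`). Suppose `R` contains a square root `r` of an integer `m ≠ 0`. Then:

* `exists_signCharacter_of_sq_eq` — the sign character `θ : Gal(R/K) → {±1}`, `σ r = θ(σ) r` (Kummer);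
* `signCharacter_galFrob_eq_jacobiSym` — **`θ(Frob_v) = (m / N v)`** (Jacobi symbol at the odd prime power
  `N v`) for every prime `v ∤ 2m` of `K`, in any finite Galois extension of number fields: the Frobenius
  congruence `Frob_v r ≡ r^{Nv} = m^{(Nv−1)/2} r (mod 𝔓)` and Euler's criterion
  (`jacobiSym_prime_pow_cast_eq_pow`: `(m/p^k) ≡ m^{(p^k−1)/2} (mod p)`);
* **`jacobiSym_absNorm_eq_one_of_sq_eq_of_ringClassField`** — for every `α ∈ 𝓞_K` with
  `α ≡ a (mod f𝓞_K)`, `a ∈ ℤ` prime to `f` (so `(α) ∈ P_{K,ℤ}(f)`), and `N(α) = N((α))` odd and prime to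
  `m`: **`(m / N(α)) = 1`**. Proof: `θ = χ ∘ Art` for a character `χ` of `I_K(f)/P_{K,ℤ}(f)` (dual Artin
  isomorphism), `χ([𝔭_v]) = θ(Frob_v) = (m/Nv)`, and `[(α)] = 1` (`idealClass_span_eq_one`), so
  `1 = χ([(α)]) = ∏_v (m/Nv)^{ν_v(α)} = (m/N(α))` (multiplicativity: induction on the factorisation of `(α)`).

This is the "genus character kills `P_{K,ℤ}(f)`" half of the genus theory of ring class fields
(Cox §9.A with §6.A Thm. 6.1 / Lemma 1.14: the characters of `Gal(R_f/K)` that come from quadratic fields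
`ℚ(√m)` are the assigned characters of the discriminant `f² d_K`), in the direction
"`√m ∈ R_f` ⟹ `(m/·)` is trivial on the values of the principal form"; it is the input of the
(⟹) direction of Voight 2007 Prop. 3.8 (`EllipticCurves/Voight2007/RingClassGenusField.lean`).

HONEST FRAMING: classical, published class field theory; no statement about elliptic curves or `L`-functions.

## Mathlib / tree search

Tree (reused by name): `galFrob`, `galFrob_spec` (`GaloisRepresentations/CyclotomicFrobenius`);
`RingClassField.exists_ringClassCharacter_of_character_galFrob` (`NumberFields/RingClassFieldAbelian`);
`RingClassField.idealClass`, `primeClass`, `idealClass_top`, `idealClass_mul`, `idealClass_span_eq_one`,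
`primeClass_of_sup_eq_top`, `sup_span_eq_top_iff_not_le` (`NumberFields/RingClassFieldOfConductor`);
`RingClass.span_sup_eq_top_of_sub_mem` (`QuadraticFields/RingClassGroup`). Mathlib: `jacobiSym.mul_right`,
`jacobiSym.legendreSym.to_jacobiSym`, `legendreSym.eq_pow`, `ZMod.pow_card`, `jacobiSym.eq_one_or_neg_one`,
`FiniteField.card`, `ringChar.Nat.cast_ringChar`, `ZMod.castHom`, `IsIntegral.of_pow`,
`UniqueFactorizationMonoid.induction_on_prime`, `Ideal.absNorm_dvd_absNorm_of_le`, `Algebra.norm_algebraMap`.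
`lean search 'jacobiSym.*absNorm|signCharacter|galFrob.*jacobi'`: no prior statement of this kind.

## References

* D. A. Cox, *Primes of the form x² + ny²*, 2nd ed. (2013): §1.C Lemma 1.14, §6.A Thm. 6.1, §8.A Thm. 8.2,
  §9.A (pp. 180–181). [Cox2013]
* J. Neukirch, *Algebraic Number Theory* (1999), Ch. VI §7 Thm. (7.1) (Artin reciprocity). [NeukirchANT1999]
* K. Ireland, M. Rosen, *A Classical Introduction to Modern Number Theory*, 2nd ed. (1990), Ch. 5 §2
  Prop. 5.2.2 (Jacobi symbol, Euler's criterion). [IrelandRosen1990]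
-/

noncomputable section

open NumberField IsDedekindDomain IsDedekindDomain.HeightOneSpectrum Polynomial
open scoped nonZeroDivisors

namespace Literature.NumberTheory.NumberFields

open Literature.NumberTheory.GaloisRepresentations Literature.NumberTheory.NumberFields.RingClassField
open Literature.NumberTheory.QuadraticFields.RingClass

/-! ### Euler's criterion for the Jacobi symbol at an odd prime power -/

/-- **Euler's criterion at a prime power:** for an odd prime `p` and `k ≥ 0`,
`(m / p^k) ≡ m^{(p^k − 1)/2} (mod p)` (the Jacobi symbol `(m/p^k) = (m/p)^k`, Euler's criterion
`(m/p) ≡ m^{(p−1)/2}`, and `x^p = x` in `𝔽_p`). [folklore] -/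
private theorem jacobiSym_prime_pow_cast_eq_pow (p : ℕ) [Fact p.Prime] (hp2 : p ≠ 2) (m : ℤ) (k : ℕ) :
    ((jacobiSym m (p ^ k) : ℤ) : ZMod p) = (m : ZMod p) ^ (p ^ k / 2) := by
  have hp : p.Prime := Fact.out
  have hodd : Odd p := hp.odd_of_ne_two hp2
  obtain ⟨q, hq⟩ := hodd
  have hq' : p / 2 = q := by omega
  induction k with
  | zero => simp [jacobiSym.one_right]
  | succ k ih =>
    haveI : NeZero (p ^ k) := ⟨pow_ne_zero _ hp.ne_zero⟩
    haveI : NeZero p := ⟨hp.ne_zero⟩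
    obtain ⟨e, he⟩ := (Odd.pow (n := k) (⟨q, hq⟩ : Odd p))
    have h1 : p ^ k / 2 = e := by omega
    have hX : p ^ k * p = 2 * (p * e + q) + 1 := by
      rw [he]
      nth_rewrite 1 [hq]
      nth_rewrite 1 [hq]
      ring
    have h2 : p ^ k * p / 2 = p * e + q := by omega
    rw [pow_succ, jacobiSym.mul_right, Int.cast_mul, ih, ← jacobiSym.legendreSym.to_jacobiSym,
      legendreSym.eq_pow, h1, hq', h2, pow_add, pow_mul, ZMod.pow_card]

/-! ### The sign character of a square root in a Galois extension -/

/-- **The quadratic character of a square root.** If `r ≠ 0` in a field `L` of characteristic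
`0` satisfies `r² = c` for `c` in the base field `F`, then every `F`-automorphism `σ` of `L` moves
`r` to `± r`, and `σ ↦ ±1` is a character `Gal(L/F) → {±1} = ℤˣ` (Kummer theory for the
quadratic extension `F(r)/F`). [folklore] -/
private theorem exists_signCharacter_of_sq_eq {F L : Type*} [Field F] [Field L] [Algebra F L] [CharZero L]
    {r : L} (hr0 : r ≠ 0) {c : F} (hr : r ^ 2 = algebraMap F L c) :
    ∃ θ : (L ≃ₐ[F] L) →* ℤˣ, ∀ σ : L ≃ₐ[F] L, σ r = ((θ σ : ℤ) : L) * r := by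
  classical
  -- every `σ` moves `r` to `± r`
  have hpm : ∀ σ : L ≃ₐ[F] L, σ r = r ∨ σ r = -r := fun σ => by
    apply sq_eq_sq_iff_eq_or_eq_neg.mp
    rw [← map_pow, hr, AlgEquiv.commutes]
  -- uniqueness of the sign
  have huniq : ∀ u u' : ℤˣ, ((u : ℤ) : L) * r = ((u' : ℤ) : L) * r → u = u' := by
    intro u u' h
    have h' : ((u : ℤ) : L) = ((u' : ℤ) : L) := mul_right_cancel₀ hr0 h
    have h'' : (u : ℤ) = (u' : ℤ) := by exact_mod_cast h'
    exact Units.ext h''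
  set s : (L ≃ₐ[F] L) → ℤˣ := fun σ => if σ r = r then 1 else -1 with hs
  have hsr : ∀ σ : L ≃ₐ[F] L, σ r = ((s σ : ℤ) : L) * r := by
    intro σ
    by_cases h : σ r = r
    · simp [hs, h]
    · rcases hpm σ with h' | h'
      · exact absurd h' h
      · have hne : -r ≠ r := by
          intro h''
          apply hr0
          have h2 : (2 : L) * r = 0 := by linear_combination (-1 : L) * h''
          rcases mul_eq_zero.mp h2 with h3 | h3
          · exact absurd h3 two_ne_zero
          · exact h3
        simp [hs, h', hne]
  refine ⟨{ toFun := s, map_one' := ?_, map_mul' := ?_ }, fun σ => hsr σ⟩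
  · apply huniq
    rw [← hsr 1]
    simp
  · intro σ τ
    apply huniq
    rw [← hsr (σ * τ), AlgEquiv.mul_apply, hsr τ, map_mul, hsr σ, map_intCast]
    push_cast
    ring

/-! ### The Frobenius of `v` acts on `√m` by the Jacobi symbol `(m / N v)` -/

section Frobenius

variable {K N : Type*} [Field K] [NumberField K] [Field N] [NumberField N] [Algebra K N]
  [IsGalois K N]

/-- **`Frob_v(√m) = (m / N v) · √m`.** Let `N/K` be a finite Galois extension of number fields,
`r ∈ N` with `r² = m ∈ ℤ`, and `θ : Gal(N/K) → {±1}` the sign character of `r` (`σ r = θ(σ) r`).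
For a prime `v` of `K` with `v ∤ 2m`, the chosen Frobenius `Frob_v = galFrob K N v` satisfies
`θ(Frob_v) = (m / N v)` (Jacobi symbol at the odd prime power `N v = #(𝓞_K/v)`): indeed
`Frob_v r ≡ r^{N v} = m^{(N v − 1)/2} · r (mod 𝔓)` and Euler's criterion in `𝓞_K/v ⊇ 𝔽_p`.
[folklore] -/
private theorem signCharacter_galFrob_eq_jacobiSym {m : ℤ} {r : N} (hr : r ^ 2 = (m : N))
    (θ : (N ≃ₐ[K] N) →* ℤˣ) (hθ : ∀ σ : N ≃ₐ[K] N, σ r = ((θ σ : ℤ) : N) * r)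
    (v : HeightOneSpectrum (𝓞 K)) (h2 : (2 : 𝓞 K) ∉ v.asIdeal) (hm : ((m : ℤ) : 𝓞 K) ∉ v.asIdeal) :
    ((θ (galFrob K N v) : ℤˣ) : ℤ) = jacobiSym m (Ideal.absNorm v.asIdeal) := by
  classical
  obtain ⟨Q, hQ, hφ⟩ := galFrob_spec K N v
  haveI : Q.IsPrime := hQ.1
  have hover : v.asIdeal = Q.under (𝓞 K) := hQ.2.over
  -- the residue field `F = 𝓞 K / v`, its characteristic `p`, `N v = p ^ n`
  haveI : v.asIdeal.IsMaximal := v.isMaximal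
  letI : Field (𝓞 K ⧸ v.asIdeal) := Ideal.Quotient.field v.asIdeal
  haveI : Finite (𝓞 K ⧸ v.asIdeal) := Ideal.finiteQuotientOfFreeOfNeBot v.asIdeal v.ne_bot
  letI : Fintype (𝓞 K ⧸ v.asIdeal) := Fintype.ofFinite _
  set p : ℕ := ringChar (𝓞 K ⧸ v.asIdeal) with hpdef
  obtain ⟨n, hp, hcard⟩ := FiniteField.card (𝓞 K ⧸ v.asIdeal) p
  haveI : Fact p.Prime := ⟨hp⟩
  have hNv : Ideal.absNorm v.asIdeal = p ^ (n : ℕ) := by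
    rw [Ideal.absNorm_apply, Submodule.cardQuot_apply, Nat.card_eq_fintype_card, hcard]
  have hpv : ((p : ℕ) : 𝓞 K) ∈ v.asIdeal := by
    rw [← Ideal.Quotient.eq_zero_iff_mem, map_natCast, hpdef]
    exact ringChar.Nat.cast_ringChar
  have hp2 : p ≠ 2 := by
    rintro h2p
    apply h2
    have := hpv
    rw [h2p] at this
    exact_mod_cast this
  have hpm : ¬ (p : ℤ) ∣ m := by
    rintro ⟨c, hc⟩
    apply hm
    rw [hc, Int.cast_mul, Int.cast_natCast]
    exact Ideal.mul_mem_right _ _ hpv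
  -- Euler's criterion in `𝓞 K / v`: `(m/Nv) ≡ m ^ (Nv / 2)`
  have heuler : ((jacobiSym m (Ideal.absNorm v.asIdeal) : ℤ) : 𝓞 K) -
      ((m : ℤ) : 𝓞 K) ^ (Ideal.absNorm v.asIdeal / 2) ∈ v.asIdeal := by
    rw [← Ideal.Quotient.eq_zero_iff_mem, map_sub, map_pow, map_intCast, map_intCast, hNv]
    have key := jacobiSym_prime_pow_cast_eq_pow p hp2 m n
    have := congrArg (ZMod.castHom (dvd_refl p) (𝓞 K ⧸ v.asIdeal)) key
    rw [map_intCast, map_pow, map_intCast] at this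
    rw [this, sub_self]
  -- `(m / N v) = ±1`
  have hcopm : IsCoprime m ((p : ℤ) ^ (n : ℕ)) :=
    (((Nat.prime_iff_prime_int.mp hp).coprime_iff_not_dvd.mpr hpm).symm).pow_right
  have hJ : jacobiSym m (Ideal.absNorm v.asIdeal) = 1 ∨
      jacobiSym m (Ideal.absNorm v.asIdeal) = -1 := by
    apply jacobiSym.eq_one_or_neg_one
    rw [hNv]
    have := Int.isCoprime_iff_gcd_eq_one.mp hcopm
    simpa using this
  -- `r` is integral; `r' = r ∈ 𝓞 N`, `r'² = m`
  have hint : IsIntegral ℤ r := by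
    refine IsIntegral.of_pow two_pos ?_
    rw [hr, show (m : N) = algebraMap ℤ N m from (eq_intCast _ m).symm]
    exact isIntegral_algebraMap
  set r' : 𝓞 N := ⟨r, hint⟩ with hr'def
  have hr'2 : r' ^ 2 = ((m : ℤ) : 𝓞 N) := by
    apply RingOfIntegers.ext
    simp [hr'def, hr]
  have hr'Q : r' ∉ Q := by
    intro h
    have h2' : r' ^ 2 ∈ Q := Q.pow_mem_of_mem h 2 two_pos
    rw [hr'2] at h2'
    apply hm
    rw [hover, Ideal.under_def, Ideal.mem_comap, map_intCast]
    exact h2'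
  -- the Frobenius congruence for `r'`
  have hfrob := hφ r'
  rw [MulSemiringAction.toAlgHom_apply] at hfrob
  have hcardq : Nat.card (𝓞 K ⧸ Q.under (𝓞 K)) = Ideal.absNorm v.asIdeal := by
    rw [← hover, Ideal.absNorm_apply, Submodule.cardQuot_apply]
  rw [hcardq] at hfrob
  set u : ℤˣ := θ (galFrob K N v) with hudef
  have hsmul : (galFrob K N v • r' : 𝓞 N) = ((u : ℤ) : 𝓞 N) * r' := by
    apply RingOfIntegers.ext
    show (galFrob K N v) • (r : N) = _
    rw [AlgEquiv.smul_def, hθ]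
    simp [hr'def, hudef]
  obtain ⟨e, he⟩ : Odd (Ideal.absNorm v.asIdeal) := by
    rw [hNv]; exact (hp.odd_of_ne_two hp2).pow
  have hediv : Ideal.absNorm v.asIdeal / 2 = e := by omega
  have hpow : r' ^ Ideal.absNorm v.asIdeal = ((m : ℤ) : 𝓞 N) ^ e * r' := by
    rw [he, pow_succ, pow_mul, hr'2]
  rw [hsmul, hpow, ← sub_mul] at hfrob
  have hmem : (((u : ℤ) : 𝓞 K) - ((m : ℤ) : 𝓞 K) ^ e) ∈ v.asIdeal := by
    rcases (‹Q.IsPrime›.mem_or_mem hfrob) with h | h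
    · rw [hover, Ideal.under_def, Ideal.mem_comap, map_sub, map_pow, map_intCast, map_intCast]
      exact h
    · exact absurd h hr'Q
  rw [hediv] at heuler
  have hdiff : (((u : ℤ) : 𝓞 K) - ((jacobiSym m (Ideal.absNorm v.asIdeal) : ℤ) : 𝓞 K)) ∈
      v.asIdeal := by
    have := Ideal.sub_mem _ hmem heuler
    convert this using 1
    ring
  -- both sides are `±1` and `2 ∉ v`
  by_contra hne
  apply h2
  rcases Int.units_eq_one_or u with hu1 | hu1 <;> rcases hJ with hJ1 | hJ1
  · exact absurd (by simp [hu1, hJ1]) hne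
  · rw [hu1, hJ1] at hdiff
    push_cast at hdiff
    convert hdiff using 1
    norm_num
  · rw [hu1, hJ1] at hdiff
    push_cast at hdiff
    have := Submodule.neg_mem _ hdiff
    convert this using 1
    norm_num
  · exact absurd (by simp [hu1, hJ1]) hne

end Frobenius

/-! ### The quadratic symbol is trivial on `P_{K,ℤ}(f)` -/

section RingClassField

variable {K : Type} [Field K] [NumberField K] (f : ℕ) [Finite (RingClassGroup K f)]

/-- **Reciprocity for a square root in the ring class field.** Let `K` be a number field, `f ≥ 1`,
and `R ⊆ K̄` a finite Galois extension of `K`, unramified off `f`, with the ring class splitting law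
"`v` splits completely `⟺ [𝔭_v] = 1` in `I_K(f)/P_{K,ℤ}(f)`" (`v ∤ f`), i.e. the ring class field of
conductor `f`. If `R` contains a square root of the integer `m ≠ 0`, then for every `α ∈ 𝓞_K` with
`α ≡ a (mod f𝓞_K)`, `a ∈ ℤ` prime to `f` (a generator of `P_{K,ℤ}(f)`), and `N(α) = N(α𝓞_K)` odd
and prime to `m`, the Jacobi symbol `(m / N(α))` equals `1`. PROOF: the sign character
`θ(σ) = σ(√m)/√m` of `Gal(R/K)` is `χ ∘ Art` for a character `χ` of `I_K(f)/P_{K,ℤ}(f)`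
(`exists_ringClassCharacter_of_character_galFrob`, Cox §9.A / Neukirch VI (7.1));
`θ(Frob_v) = (m / N v)` (`signCharacter_galFrob_eq_jacobiSym`); and `[(α)] = 1`
(`idealClass_span_eq_one`), so `1 = χ([(α)]) = ∏_v χ([𝔭_v])^{ν_v(α)} = ∏_v (m/Nv)^{ν_v} = (m/N(α))`.
[cite: Cox2013, §9.A (pp. 180–181) and §8.A Thm. 8.2] [cite: NeukirchANT1999, Ch. VI §7 Thm. (7.1)] -/
theorem jacobiSym_absNorm_eq_one_of_sq_eq_of_ringClassField (hf : f ≠ 0)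
    (R : IntermediateField K (AlgebraicClosure K)) [FiniteDimensional K R] [IsGalois K R]
    (hunr : ∀ v : HeightOneSpectrum (𝓞 K), ¬ Ideal.span {(f : 𝓞 K)} ≤ v.asIdeal →
      Algebra.IsUnramifiedIn (𝓞 R) v.asIdeal)
    (hsplit : ∀ v : HeightOneSpectrum (𝓞 K), ¬ Ideal.span {(f : 𝓞 K)} ≤ v.asIdeal →
      (v ∈ splitPrimes K R ↔ RingClassField.primeClass f v = 1))
    {m : ℤ} (hm0 : m ≠ 0) (r : R) (hr : r ^ 2 = (m : R))
    {α : 𝓞 K} {a : ℤ} (ha : IsCoprime a (f : ℤ)) (hα : α - (a : 𝓞 K) ∈ Ideal.span {(f : 𝓞 K)})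
    (hodd : Odd (Ideal.absNorm (Ideal.span {α})))
    (hcop : IsCoprime ((Ideal.absNorm (Ideal.span {α}) : ℕ) : ℤ) m) :
    jacobiSym m (Ideal.absNorm (Ideal.span {α})) = 1 := by
  classical
  haveI : NumberField R := NumberField.of_module_finite K R
  -- the sign character of `r = √m`
  have hr0 : (r : R) ≠ 0 := by
    intro h
    rw [h, zero_pow two_ne_zero] at hr
    exact hm0 (by exact_mod_cast hr.symm)
  obtain ⟨θ₀, hθ₀⟩ := exists_signCharacter_of_sq_eq (F := K) hr0 (c := (m : K)) (by rw [hr]; simp)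
  set θ : (R ≃ₐ[K] R) →* ℂˣ := (Units.map (Int.castRingHom ℂ : ℤ →* ℂ)).comp θ₀ with hθdef
  obtain ⟨χ, hχ⟩ := exists_ringClassCharacter_of_character_galFrob f hf R hunr hsplit θ
  -- `χ([𝔭_v]) = (m / N v)` for `v ∤ 2 m f`
  have hprime : ∀ v : HeightOneSpectrum (𝓞 K), ¬ Ideal.span {(f : 𝓞 K)} ≤ v.asIdeal →
      (2 : 𝓞 K) ∉ v.asIdeal → ((m : ℤ) : 𝓞 K) ∉ v.asIdeal →
      ((χ (RingClassField.primeClass f v) : ℂˣ) : ℂ) =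
        (jacobiSym m (Ideal.absNorm v.asIdeal) : ℂ) := by
    intro v hv h2 hmv
    rw [← hχ v hv, hθdef, MonoidHom.comp_apply, Units.coe_map,
      ← signCharacter_galFrob_eq_jacobiSym hr θ₀ hθ₀ v h2 hmv]
    simp
  -- norms of primes containing `2` or `m`
  have hnorm2 : ∀ q : Ideal (𝓞 K), q.IsPrime → Odd (Ideal.absNorm q) → (2 : 𝓞 K) ∉ q := by
    intro q hq hoddq h2q
    have hdvd : Ideal.absNorm q ∣ Ideal.absNorm (Ideal.span {(2 : 𝓞 K)}) :=
      Ideal.absNorm_dvd_absNorm_of_le ((Ideal.span_singleton_le_iff_mem _).mpr h2q)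
    rw [Ideal.absNorm_span_singleton, show (2 : 𝓞 K) = algebraMap ℤ (𝓞 K) 2 by simp,
      Algebra.norm_algebraMap, Int.natAbs_pow] at hdvd
    obtain ⟨j, -, hj⟩ := (Nat.dvd_prime_pow Nat.prime_two).mp (by simpa using hdvd)
    rw [hj] at hoddq
    rcases Nat.eq_zero_or_pos j with hj0 | hjpos
    · rw [hj0, pow_zero, Ideal.absNorm_eq_one_iff] at hj
      exact hq.ne_top hj
    · exact absurd ((Nat.odd_pow_iff hjpos.ne').mp hoddq) (by decide)
  have hnormm : ∀ q : Ideal (𝓞 K), q.IsPrime → IsCoprime ((Ideal.absNorm q : ℕ) : ℤ) m →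
      ((m : ℤ) : 𝓞 K) ∉ q := by
    intro q hq hcopq hmq
    have hdvd : Ideal.absNorm q ∣ Ideal.absNorm (Ideal.span {((m : ℤ) : 𝓞 K)}) :=
      Ideal.absNorm_dvd_absNorm_of_le ((Ideal.span_singleton_le_iff_mem _).mpr hmq)
    rw [Ideal.absNorm_span_singleton, show ((m : ℤ) : 𝓞 K) = algebraMap ℤ (𝓞 K) m by simp,
      Algebra.norm_algebraMap, Int.natAbs_pow] at hdvd
    have hcop' : Nat.Coprime (Ideal.absNorm q) (m.natAbs ^ Module.finrank ℤ (𝓞 K)) := by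
      have h1 := Int.isCoprime_iff_gcd_eq_one.mp
        (hcopq.pow_right : IsCoprime _ (m ^ Module.finrank ℤ (𝓞 K)))
      rw [Int.gcd_eq_natAbs] at h1
      simpa [Int.natAbs_pow] using h1
    have h1 : Ideal.absNorm q = 1 := Nat.Coprime.eq_one_of_dvd hcop' hdvd
    rw [Ideal.absNorm_eq_one_iff] at h1
    exact hq.ne_top h1
  -- multiplicativity: induction on the factorisation of an ideal prime to `2 m f`
  have key : ∀ I : Ideal (𝓞 K), ∀ (hI0 : I ≠ ⊥) (hIc : I ⊔ Ideal.span {(f : 𝓞 K)} = ⊤),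
      Odd (Ideal.absNorm I) → IsCoprime ((Ideal.absNorm I : ℕ) : ℤ) m →
      ((χ (RingClassField.idealClass f hI0 hIc) : ℂˣ) : ℂ) =
        (jacobiSym m (Ideal.absNorm I) : ℂ) := by
    intro I
    refine UniqueFactorizationMonoid.induction_on_prime I (fun h => absurd rfl h) ?_ ?_
    · intro J hJ hJ0 hJc _ _
      rw [Ideal.isUnit_iff] at hJ
      subst hJ
      rw [RingClassField.idealClass_top, map_one, Units.val_one, Ideal.absNorm_top,
        jacobiSym.one_right, Int.cast_one]
    · intro J q hJ0 hq ih hqJ0 hqJc hoddp hcopp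
      have hq0 : q ≠ ⊥ := hq.ne_zero
      haveI hqp : q.IsPrime := Ideal.isPrime_of_prime hq
      set v : HeightOneSpectrum (𝓞 K) := ⟨q, hqp, hq0⟩ with hvdef
      have hqc : q ⊔ Ideal.span {(f : 𝓞 K)} = ⊤ :=
        top_le_iff.mp (hqJc ▸ sup_le_sup_right Ideal.mul_le_right _)
      have hJc : J ⊔ Ideal.span {(f : 𝓞 K)} = ⊤ :=
        top_le_iff.mp (hqJc ▸ sup_le_sup_right Ideal.mul_le_left _)
      have hNmul : Ideal.absNorm (q * J) = Ideal.absNorm q * Ideal.absNorm J := map_mul _ _ _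
      rw [hNmul] at hoddp hcopp
      have hoddq : Odd (Ideal.absNorm q) := (Nat.odd_mul.mp hoddp).1
      have hoddJ : Odd (Ideal.absNorm J) := (Nat.odd_mul.mp hoddp).2
      push_cast at hcopp
      have hcopq : IsCoprime ((Ideal.absNorm q : ℕ) : ℤ) m := hcopp.of_mul_left_left
      have hcopJ : IsCoprime ((Ideal.absNorm J : ℕ) : ℤ) m := hcopp.of_mul_left_right
      have hvf : ¬ Ideal.span {(f : 𝓞 K)} ≤ v.asIdeal :=
        (RingClassField.sup_span_eq_top_iff_not_le f).mp hqc
      haveI : NeZero (Ideal.absNorm q) := ⟨Ideal.absNorm_eq_zero_iff.not.mpr hq0⟩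
      haveI : NeZero (Ideal.absNorm J) := ⟨Ideal.absNorm_eq_zero_iff.not.mpr hJ0⟩
      rw [RingClassField.idealClass_mul f hq0 hJ0 hqc hJc hqJc, map_mul, Units.val_mul,
        ih hJ0 hJc hoddJ hcopJ, ← RingClassField.primeClass_of_sup_eq_top f (v := v) hqc,
        hprime v hvf (hnorm2 q hqp hoddq) (hnormm q hqp hcopq), hNmul, jacobiSym.mul_right,
        Int.cast_mul]
  -- apply to `(α)`, whose class is trivial
  have hα0 : α ≠ 0 := by
    rintro rfl
    simp at hodd
  have hI0 : Ideal.span {α} ≠ ⊥ := by simpa [Ideal.span_singleton_eq_bot] using hα0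
  have hIc : Ideal.span {α} ⊔ Ideal.span {(f : 𝓞 K)} = ⊤ := span_sup_eq_top_of_sub_mem ha hα
  have h1 : RingClassField.idealClass f hI0 hIc = 1 :=
    RingClassField.idealClass_span_eq_one f hα0 ha hα hIc
  have := key (Ideal.span {α}) hI0 hIc hodd hcop
  rw [h1, map_one, Units.val_one] at this
  exact_mod_cast this.symm

end RingClassField

end Literature.NumberTheory.NumberFields

end
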